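import Summits.BirchSwinnertonDyer.BirchSwinnertonDyer.Theorems.SchneiderFreeAdditiveX3QuadraticGoodReductionDichotomy
import Summits.BirchSwinnertonDyer.Rank1Residual.Additive.GordDescentField
import Summits.BirchSwinnertonDyer.Rank1Residual.Additive.QuadraticTwistTypeGOrd
import Summits.BirchSwinnertonDyer.Rank1Residual.AdditivePotMult.QuadraticTwistTamagawaGood
import Summits.BirchSwinnertonDyer.Rank1Residual.Supersingular.TwistStability
import Literature.NumberTheory.EllipticCurves.Rank1Residual.GVParityTwistProofs
import Literature.NumberTheory.EllipticCurves.KellerYin2024.PotentiallyGoodOrdinaryIwasawaTheory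
import Literature.FieldTheory.Galois.SolvableCompositum
import HarnessLib

/-!
# Route `SchneiderFreeAdditiveX3` (K1 door): DESCENT OF GOOD REDUCTION ALONG A QUADRATIC FIELD — an elliptic curve over `ℚ` that is
# ADDITIVE at an odd `p` and good ordinary above `p` over a field of degree `≤ 2` is `C • V^{(p*)}` with `V` good ORDINARY at `p`

Cell `bsd-schneider-ideate`, seat `bsd-schneider-door-c5` (prover, generation 30; assembly layer; `--supports` 19177, helper).
PARTITION: board row B6 ∩ X3 ∩ sst-twist, `r = 1` (7 101 pairs; (G-ord, `e = 2`) half 2 560, of which 2 411 at `p = 3`);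
types-the-object-of nothing new; supplies the missing lemma (C5) of generation 29's diagnosis (FINDING-door-c5-g29 §2c) in the SHAPE
THE DOOR'S LOCAL LEMMAS CONSUME, at every odd `p` including `3`; closes none of B6's cells (BSD NOT advanced).
bears_on: K1-door (items 18971/18972 → 19177 r3 `GordTwoBranchIMC`).

Sequel to `…QuadraticGoodReductionDichotomy` (the dichotomy and the twist).  This file:
* §5 `mul_mem_range_absGaloisRestrict_iff`, `exists_squarefree_sq_eq_stabilizer` — for `[F : ℚ] = 2`: `res(Γ_F) ≤ Γ_ℚ` has the
  index-two property, and is the stabiliser of `√d` for a squarefree integer `d` with `√d ∈ F` (Galois theory of the quadratic field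
  through the tree's `absGaloisQuot`).
* §5b `not_dvd_frobeniusTrace_of_hasUnitRootAt_baseChange` — ORDINARITY DESCENDS: `E` good at `p`, `E_M` with the unit-root
  condition at some `w ∣ p` ⟹ `p ∤ a_p(E)` (`a_w = D_f(a_p, p) ≡ a_p^f`, the tree's Dickson recursion read backwards).
* §5c **`exists_goodOrd_pStar_twist_presentation_of_addv_of_caseOne`** — `p` odd, `E` ADDITIVE at `p` and of Keller–Yin's Case (I)
  (`HasGoodOrdinaryReductionOverQuadraticAt`): `E = C • V^{(p*)}` with `V` globally minimal and `GoodOrd V p`.  (Degree `1` is excluded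
  by the dichotomy; in degree `2` the dichotomy gives the sign action and a mover `σ₀`; `E^{(d)}` is good at `p`; `σ₀` moves `√d` while
  inertia fixes `√m` for `p ∤ m`, so `d = p m`; `E^{(p*)} ≅ (E^{(d)})^{(±m)}` is good at `p`; ordinarity by §5b and twist stability.)

HONEST FRAMING: theorems about elliptic curves over `ℚ` proved from tree theorems; no named fact, no definition, no `sorry`; nothing
asserted about BSD; «closes rung: none».  PRESEARCH: as in the prequel (Serre–Tate 1968 §2, Kraus 1990 Thm. 1: folklore; new in the
tree at `p = 3`).

References: J.-P. Serre, J. Tate, Ann. of Math. 88 (1968) §2; A. Kraus, Manuscripta Math. 69 (1990) (shape); J. H. Silverman, AEC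
VII.4.1, VII.7.1, X.5 Cor. 5.4, V Ex. 5.10; A. Knapp, Elliptic Curves (1993) Prop. 12.10 (a_p of a twist); D. Marcus, Number Fields Ch. 2.
-/

set_option autoImplicit false
set_option linter.dupNamespace false

noncomputable section

open scoped Classical NumberField Pointwise

open Field NumberField IsDedekindDomain WeierstrassCurve IsDedekindDomain.HeightOneSpectrum Rat.HeightOneSpectrum
  Literature.NumberTheory.EllipticCurves Literature.NumberTheory.GaloisRepresentations
  Literature.NumberTheory.EllipticCurves.Rank1Residual
  Summit.BirchSwinnertonDyer.Rank1Residual Summit.BirchSwinnertonDyer.Rank1Residual.GaloisImage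
  Summit.BirchSwinnertonDyer.Rank1Residual.Additive
  Summit.BirchSwinnertonDyer.BirchSwinnertonDyer.Theorems.ResidualLineRigidity
  Summit.BirchSwinnertonDyer.BirchSwinnertonDyer.Theorems.SchneiderFreeAdditiveX3.TwistThreeResidualPair
  Summit.BirchSwinnertonDyer.BirchSwinnertonDyer.Theorems.SchneiderFreeAdditiveX3.SemistableTwistLocalAnyLine

namespace Summit.BirchSwinnertonDyer.BirchSwinnertonDyer.Theorems.SchneiderFreeAdditiveX3.QuadraticGoodReductionDescent

/-! ### §5 Quadratic fields: the index-two subgroup `res(Γ_F)`, a square-root generator, ordinarity descent, and the normal form -/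

section Quadratic

variable (F : Type) [Field F] [NumberField F]

/-- **`res(Γ_F)` has the index-two property when `[F : ℚ] = 2`**: `a b ∈ H ↔ (a ∈ H ↔ b ∈ H)` for `H = res(Γ_F) ≤ Γ_ℚ`
(`H` is the kernel of `Γ_ℚ → Gal(F/ℚ)`, a group of order `2`). [cite: NeukirchANT1999, Ch. IV §1] -/
theorem mul_mem_range_absGaloisRestrict_iff (hF : Module.finrank ℚ F = 2) (a b : absoluteGaloisGroup ℚ) :
    a * b ∈ (absGaloisRestrict ℚ F).range ↔ (a ∈ (absGaloisRestrict ℚ F).range ↔ b ∈ (absGaloisRestrict ℚ F).range) := by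
  haveI : IsGalois ℚ F := Literature.FieldTheory.Galois.isGalois_of_finrank_eq_two hF
  have hker : (absGaloisQuot ℚ F).ker = (absGaloisRestrict ℚ F).range := by
    ext τ
    rw [MonoidHom.mem_ker, absGaloisQuot_eq_one_iff]
  have hidx : ((absGaloisRestrict ℚ F).range).index = 2 := by
    rw [← hker, Subgroup.index_ker, MonoidHom.range_eq_top.mpr (absGaloisQuot_surjective ℚ F), Subgroup.card_top,
      IsGalois.card_aut_eq_finrank, hF]
  exact Subgroup.mul_mem_iff_of_index_two hidx

/-- **A square-root generator of a quadratic field, read on `Γ_ℚ`.**  For `[F : ℚ] = 2` there are a squarefree integer `d ≠ 0` and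
`y ∈ F` with `y² = d` such that `res(Γ_F)` is exactly the stabiliser of `√d ∈ ℚ̄`: with `c` the non-trivial automorphism and any
`x` moved by `c`, `y₀ = x − c x ≠ 0` has `c y₀ = −y₀`, `y₀² = −N(y₀) ∈ ℚ`; clear denominators and the square part.
[cite: Marcus1977, Ch. 2 Thm. 1 (quadratic fields are ℚ(√d), d squarefree)] -/
theorem exists_squarefree_sq_eq_stabilizer (hF : Module.finrank ℚ F = 2) :
    ∃ (d : ℤ) (y : F), d ≠ 0 ∧ Squarefree d ∧ y ^ 2 = (d : F) ∧
      ∀ τ : absoluteGaloisGroup ℚ, τ ∈ (absGaloisRestrict ℚ F).range ↔ τ • geomSqrt (d : ℚ) = geomSqrt (d : ℚ) := by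
  haveI : IsGalois ℚ F := Literature.FieldTheory.Galois.isGalois_of_finrank_eq_two hF
  have hcard : Nat.card (F ≃ₐ[ℚ] F) = 2 := by rw [IsGalois.card_aut_eq_finrank, hF]
  -- the non-trivial automorphism `c`, `c² = 1`, every automorphism is `1` or `c`
  obtain ⟨c, hc1, hcuniq⟩ := (Nat.card_eq_two_iff' (1 : F ≃ₐ[ℚ] F)).mp hcard
  have hcc : c * c = 1 := by
    have h := orderOf_dvd_natCard c
    rw [hcard, orderOf_dvd_iff_pow_eq_one, sq] at h
    exact h
  have hall : ∀ g : F ≃ₐ[ℚ] F, g = 1 ∨ g = c := fun g ↦ by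
    by_cases hg : g = 1
    · exact Or.inl hg
    · exact Or.inr (hcuniq g hg)
  -- an element moved by `c`
  obtain ⟨x, hx⟩ : ∃ x : F, c x ≠ x := by
    by_contra h
    push Not at h
    exact hc1 (AlgEquiv.ext h)
  set y₀ : F := x - c x with hy₀
  have hy₀0 : y₀ ≠ 0 := fun h ↦ hx (sub_eq_zero.mp h).symm
  have hcy₀ : c y₀ = -y₀ := by
    rw [hy₀, map_sub, show c (c x) = (c * c) x from rfl, hcc, AlgEquiv.one_apply, neg_sub]
  -- `y₀² ∈ ℚ` (fixed by `Gal(F/ℚ)`)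
  have hfix : ∀ g : F ≃ₐ[ℚ] F, g (y₀ ^ 2) = y₀ ^ 2 := fun g ↦ by
    rcases hall g with rfl | rfl
    · rfl
    · rw [map_pow, hcy₀, neg_sq]
  obtain ⟨q, hq⟩ : ∃ q : ℚ, algebraMap ℚ F q = y₀ ^ 2 := by
    have hmem : y₀ ^ 2 ∈ IntermediateField.fixedField (⊤ : Subgroup (F ≃ₐ[ℚ] F)) := fun g ↦ hfix g
    rw [IsGalois.fixedField_top, IntermediateField.mem_bot] at hmem
    exact hmem
  have hq0 : q ≠ 0 := by
    rintro rfl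
    rw [map_zero] at hq
    exact hy₀0 (pow_eq_zero_iff two_ne_zero |>.mp hq.symm)
  -- clear denominators: `y₁ = den • y₀`, `y₁² = num * den ∈ ℤ`
  set n : ℤ := q.num * q.den with hn
  have hn0 : n ≠ 0 := mul_ne_zero (Rat.num_ne_zero.mpr hq0) (by exact_mod_cast q.den_ne_zero)
  set y₁ : F := (q.den : F) * y₀ with hy₁
  have hy₁sq : y₁ ^ 2 = (n : F) := by
    rw [hy₁, mul_pow, ← hq, hn, Int.cast_mul, Int.cast_natCast]
    have h : (q.den : F) ^ 2 * algebraMap ℚ F q = algebraMap ℚ F (q.den ^ 2 * q) := by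
      rw [map_mul, map_pow, map_natCast]
    have hq' : (q.den : ℚ) ^ 2 * q = (q.num : ℚ) * q.den := by
      rw [sq, mul_assoc, Rat.den_mul_eq_num, mul_comm]
    rw [h, hq', map_mul, map_intCast, map_natCast]
  -- squarefree part: `|n| = b² a`, `a` squarefree; `d = sign(n) a`, `y = y₁ / b`
  obtain ⟨a, b, -, hb0', hba, hsqa⟩ := Nat.sq_mul_squarefree_of_pos (Int.natAbs_pos.mpr hn0)
  set d : ℤ := n.sign * (a : ℕ) with hd
  have hb0 : ((b : ℕ) : F) ≠ 0 := by exact_mod_cast hb0'.ne'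
  have hnd : n = ((b : ℕ) : ℤ) ^ 2 * d := by
    rw [hd, ← mul_assoc, mul_comm (_ ^ 2) n.sign, mul_assoc, ← Int.sign_mul_natAbs n]
    congr 1
    rw [Int.sign_mul_natAbs n]
    exact_mod_cast hba.symm
  set y : F := y₁ / ((b : ℕ) : F) with hy
  have hysq : y ^ 2 = (d : F) := by
    rw [hy, div_pow, hy₁sq, hnd, Int.cast_mul, Int.cast_pow, Int.cast_natCast, mul_div_cancel_left₀ _ (pow_ne_zero 2 hb0)]
  have hd0 : d ≠ 0 := by
    intro h
    rw [h, mul_zero] at hnd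
    exact hn0 hnd
  have hdsq : Squarefree d := by
    rw [← Int.squarefree_natAbs, hd, Int.natAbs_mul, Int.natAbs_sign_of_ne_zero hn0, one_mul, Int.natAbs_natCast]
    exact hsqa
  -- `c y = -y`, `y ≠ 0`
  have hcy : c y = -y := by
    rw [hy, map_div₀, hy₁, map_mul, map_natCast, map_natCast, hcy₀, mul_neg, neg_div]
  have hy0 : y ≠ 0 := by
    rw [hy, hy₁]
    exact div_ne_zero (mul_ne_zero (by exact_mod_cast q.den_ne_zero) hy₀0) hb0
  -- the embedded `y` is `±√d`
  have hysq' : y ^ 2 = algebraMap ℚ F (d : ℚ) := by rw [hysq, map_intCast]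
  have hey : absEmbedding ℚ F y = geomSqrt (d : ℚ) ∨ absEmbedding ℚ F y = -geomSqrt (d : ℚ) := by
    apply sq_eq_sq_iff_eq_or_eq_neg.mp
    rw [geomSqrt_sq, ← map_pow, hysq', AlgHom.commutes]
  have hey0 : absEmbedding ℚ F y ≠ 0 := fun h ↦ hy0 ((absEmbedding ℚ F).injective (h.trans (map_zero _).symm))
  refine ⟨d, y, hd0, hdsq, hysq, fun τ ↦ ⟨fun hτ ↦ ?_, fun hτ ↦ ?_⟩⟩
  · -- `τ ∈ H` fixes `e(y) = ±√d`
    have h := (mem_range_absGaloisRestrict_iff_smul_absEmbedding ℚ F τ).mp hτ y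
    rcases hey with he | he
    · rwa [he] at h
    · rw [he, smul_neg] at h
      exact neg_injective h
  · -- `τ ∉ H` would act as `c`, negating `e(y)`
    by_contra hτH
    have hq1 : absGaloisQuot ℚ F τ ≠ 1 := fun h ↦ hτH ((absGaloisQuot_eq_one_iff ℚ F τ).mp h)
    have hqc : absGaloisQuot ℚ F τ = c := hcuniq _ hq1
    have h := absEmbedding_absGaloisQuot_apply ℚ F τ y
    rw [hqc, hcy, map_neg] at h
    -- `τ • e(y) = -e(y)` but `τ` fixes `√d`
    have h' : τ • absEmbedding ℚ F y = absEmbedding ℚ F y := by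
      rcases hey with he | he
      · rw [he, hτ]
      · rw [he, smul_neg, hτ]
    rw [h'] at h
    have h2 : absEmbedding ℚ F y + absEmbedding ℚ F y = 0 := by
      nth_rw 1 [← h]; exact neg_add_cancel _
    exact hey0 (add_self_eq_zero.mp h2)

end Quadratic

/-! ### §5b Ordinarity descends from `E_M` at `w ∣ p` to `E` at `p` -/

section OrdinaryDescent

variable {p : ℕ} [hp : Fact p.Prime] (V : WeierstrassCurve ℚ) [V.IsElliptic] [V.IsGloballyMinimal]
  (M : Type) [Field M] [NumberField M]

/-- **Ordinarity descends.**  If `E/ℚ` (globally minimal) is good at `p` and `E_M` satisfies the unit-root condition at some `w ∣ p`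
of a number field `M`, then `p ∤ a_p(E)`: `a_w = D_f(a_p, p) ≡ a_p^f (mod p)` (the Dickson recursion of the tree's ascent theorem
`hasUnitRootAt_baseChange_of_hasGoodReductionAt`, read backwards). [cite: SilvermanAEC2009, V Ex. 5.10(a), V.2.3.1] [cite: GreenbergLNM1716, Thm 1.2 and §4 p. 103] -/
theorem not_dvd_frobeniusTrace_of_hasUnitRootAt_baseChange {w : HeightOneSpectrum (𝓞 M)} (hpw : (p : 𝓞 M) ∈ w.asIdeal)
    (hgood : V.HasGoodReductionAtPrime p) (hunit : (V.baseChange M).HasUnitRootAt w) : ¬ (p : ℤ) ∣ V.frobeniusTrace p := by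
  set v : HeightOneSpectrum (𝓞 ℚ) := (primesEquiv (R := 𝓞 ℚ)).symm ⟨p, hp.out⟩ with hvdef
  have hpv : (p : 𝓞 ℚ) ∈ v.asIdeal := (natCast_mem_asIdeal_iff_eq_primesEquiv_symm v hp.out).mpr hvdef
  have hw : w.asIdeal.under (𝓞 ℚ) = v.asIdeal := under_eq_asIdeal_of_natCast_mem p w hpw
  rw [← V.hasUnitRootAt_iff_not_dvd_frobeniusTrace v hp.out hpv]
  have hgoodv : V.HasGoodReductionAt v := V.hasGoodReductionAt_of_hasGoodReductionAtPrime v hpv hgood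
  have hcv : ringChar (IsLocalRing.ResidueField (v.adicCompletionIntegers ℚ)) = p := ringChar_residueField_eq v hp.out hpv
  have hcw : ringChar (IsLocalRing.ResidueField (w.adicCompletionIntegers M)) = p := ringChar_residueField_eq w hp.out hpw
  have hqv : (p : ℤ) ∣ (Nat.card (IsLocalRing.ResidueField (v.adicCompletionIntegers ℚ)) : ℤ) := by
    rw [← hcv]
    exact Int.natCast_dvd_natCast.mpr (ringChar_residueField_dvd_natCard v)
  haveI : w.asIdeal.LiesOver v.asIdeal := ⟨hw.symm⟩
  have hgoodw : (V.baseChange M).HasGoodReductionAt w := hasGoodReductionAt_baseChange_of_hasGoodReductionAt V M v w hgoodv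
  have hup := V.localPolynomialAt_baseChange_of_hasGoodReductionAt M hw hgoodv (localPolynomialAt_of_hasGoodReductionAt hgoodv)
  rw [localPolynomialAt_of_hasGoodReductionAt hgoodw] at hup
  have haw := WeierstrassCurve.eq_of_one_sub_C_mul_X_add_eq hup
  have hf : 0 < w.asIdeal.inertiaDeg (𝓞 ℚ) := by
    haveI : w.asIdeal.IsMaximal := w.isMaximal
    exact Ideal.inertiaDeg_pos w.asIdeal (𝓞 ℚ)
  obtain ⟨f, hf'⟩ : ∃ f, w.asIdeal.inertiaDeg (𝓞 ℚ) = f + 1 := ⟨_, (Nat.succ_pred_eq_of_pos hf).symm⟩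
  rw [hasUnitRootAt_iff_not_dvd_frobeniusTraceAt, hcw, haw, hf'] at hunit
  rw [hasUnitRootAt_iff_not_dvd_frobeniusTraceAt, hcv]
  intro hdvd
  apply hunit
  have hD := dvd_dickson_one_eval_sub_pow (V.frobeniusTraceAt v)
    (Nat.card (IsLocalRing.ResidueField (v.adicCompletionIntegers ℚ)) : ℤ) f
  have hpow : (p : ℤ) ∣ V.frobeniusTraceAt v ^ (f + 1) := dvd_pow hdvd (Nat.succ_ne_zero f)
  have := dvd_add (dvd_trans hqv hD) hpow
  simpa using this

end OrdinaryDescent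

/-! ### §5c THE NORMAL FORM: an additive `p` of Case (I) is a `p*`-twist of a good ORDINARY curve (every odd `p`, incl. `p = 3`) -/

section NormalForm

variable {p : ℕ} [hp : Fact p.Prime]

omit hp in
/-- `p ∤ d` and `p` odd give `p ∤ 4d`. [folklore] -/
theorem not_dvd_four_mul (hpP : p.Prime) (hp2 : p ≠ 2) {d : ℤ} (hpd : ¬ (p : ℤ) ∣ d) : ¬ (p : ℤ) ∣ 4 * d := by
  intro h
  have hpZ : Prime (p : ℤ) := Nat.prime_iff_prime_int.mp hpP
  rcases hpZ.dvd_or_dvd h with h4 | hd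
  · have h22 : (p : ℤ) ∣ 2 * 2 := by norm_num at h4 ⊢; exact h4
    rcases hpZ.dvd_or_dvd h22 with h2 | h2 <;>
    · have : (p : ℤ) ∣ ((2 : ℕ) : ℤ) := by exact_mod_cast h2
      rw [Int.natCast_dvd_natCast] at this
      exact hp2 ((Nat.prime_dvd_prime_iff_eq hpP Nat.prime_two).mp this)
  · exact hpd hd

/-- **THE NORMAL FORM.**  Let `p` be an odd prime, `E = W/ℚ` an elliptic curve ADDITIVE at `p` which becomes good ORDINARY above `p`
over some number field of degree `≤ 2` (`HasGoodOrdinaryReductionOverQuadraticAt`, Keller–Yin's Case (I)).  Then `W = C • V^{(p*)}`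
for a globally minimal `V/ℚ` with GOOD ORDINARY reduction at `p` (`GoodOrd V p`) — the presentation every local lemma of the door
consumes (`not_fix_and_not_quot_of_goodOrd_pStar_twist(_of_not_anomalous)`, the `p = 3` partner road).  Proof: the degree is `2`
(degree `1` would make `E` good at `p`, §4); by §4 and additivity inertia acts on almost all `E[ℓ]` through the sign of `Gal(F/ℚ)`;
with `F = ℚ(√d)`, `d` squarefree (§5), `E^{(d)}` is good at `p` (§4b); an inertia element outside `res(Γ_F)` moves `√d`, so `p ∣ d`
(inertia fixes `√m` for `p ∤ m`), `d = p m`, and `E^{(p*)} ≅ (E^{(d)})^{(±m)}` is good at `p`; ordinarity: `E^{(d)}_F ≅ E_F` has the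
unit-root condition at `w`, which descends (§5b) and is stable under the twist by `±m`, `p ∤ 2m` (`dvd_frobeniusTrace_iff_of_smul_eq_quadraticTwist`).
[cite: SilvermanAEC2009, Thm. VII.7.1, Prop. VII.4.1, X.5 Cor. 5.4] [cite: Serre1972, §1.11] [cite: Knapp1993, Prop. 12.10 (a_p of a twist)] -/
theorem exists_goodOrd_pStar_twist_presentation_of_addv_of_caseOne (hp2 : p ≠ 2) (W : WeierstrassCurve ℚ) [W.IsElliptic]
    (hadd : Addv W p) (hcase : W.HasGoodOrdinaryReductionOverQuadraticAt p) :
    ∃ (V : WeierstrassCurve ℚ) (_ : V.IsElliptic) (_ : V.IsGloballyMinimal) (C : VariableChange ℚ),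
      GoodOrd V p ∧ C • V.quadraticTwist ((-1 : ℚ) ^ (p / 2) * p) = W := by
  have hpP : p.Prime := hp.out
  obtain ⟨F, _, _, w, hF2, hw, hgoodF, hunitF⟩ := hcase
  -- the place `v` of `ℚ` at `p`, a prime `𝔓_F ∣ w` of `\bar ℤ_F`
  set v : HeightOneSpectrum (𝓞 ℚ) := (primesEquiv (R := 𝓞 ℚ)).symm ⟨p, hpP⟩ with hvdef
  have hpv : (p : 𝓞 ℚ) ∈ v.asIdeal := (natCast_mem_asIdeal_iff_eq_primesEquiv_symm v hpP).mpr hvdef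
  have hpv' : ((p : ℕ) : 𝓞 ℚ) ∈ v.asIdeal := hpv
  have hveq : (primesEquiv v : Nat.Primes) = ⟨p, hpP⟩ := by rw [hvdef, Equiv.apply_symm_apply]
  have hwv : w.asIdeal.under (𝓞 ℚ) = v.asIdeal := under_eq_asIdeal_of_natCast_mem p w hw
  obtain ⟨𝔓F, h𝔓F⟩ := w.primesAbove_nonempty
  have hnotgood : ¬ W.HasGoodReductionAt v := fun h ↦ hadd.1 (W.hasGoodReductionAtPrime_of_hasGoodReductionAt v hpv h)
  haveI : (W.baseChange F).IsElliptic := inferInstanceAs (W.map (algebraMap ℚ F)).IsElliptic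
  -- the degree is `2`: in degree `1`, `res(Γ_F) = Γ_ℚ` and §4 makes `E` good at `p`
  have hF : Module.finrank ℚ F = 2 := by
    have hpos : 0 < Module.finrank ℚ F := Module.finrank_pos
    rcases (show Module.finrank ℚ F = 1 ∨ Module.finrank ℚ F = 2 by omega) with h1 | h2
    · exfalso
      have htop : ∀ τ : absoluteGaloisGroup ℚ, τ ∈ (absGaloisRestrict ℚ F).range := by
        intro τ
        rw [mem_range_absGaloisRestrict_iff_smul_absEmbedding]
        intro x
        have hx : x ∈ (⊥ : Subalgebra ℚ F) := by
          rw [Subalgebra.bot_eq_top_iff_finrank_eq_one.mpr h1]; exact Algebra.mem_top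
        obtain ⟨q, rfl⟩ := Algebra.mem_bot.mp hx
        rw [AlgHom.commutes, absoluteGaloisGroup.smul_def, AlgEquiv.commutes]
      rcases hasGoodReductionAt_or_forall_inertia_smul_eq_neg W F hw hgoodF h𝔓F hpv' hwv
        (fun a b ↦ by simp only [htop]) with hgood | ⟨⟨σ₀, -, hσ₀⟩, -⟩
      · exact hnotgood hgood
      · exact hσ₀ (htop σ₀)
    · exact h2
  -- §4 in degree `2`: the sign action and a mover `σ₀ ∈ I_𝔓 ∖ H`
  have hH := mul_mem_range_absGaloisRestrict_iff F hF
  obtain ⟨⟨σ₀, hσ₀I, hσ₀H⟩, S, hS, hneg⟩ :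
      (∃ σ₀ ∈ (𝔓F.comap (absIntegersMap ℚ F)).inertia (absoluteGaloisGroup ℚ), σ₀ ∉ (absGaloisRestrict ℚ F).range) ∧
      ∃ S : Set ℕ, S.Finite ∧ ∀ ℓ : ℕ, ℓ.Prime → ℓ ∉ S →
        ∀ τ ∈ (𝔓F.comap (absIntegersMap ℚ F)).inertia (absoluteGaloisGroup ℚ), τ ∉ (absGaloisRestrict ℚ F).range →
          ∀ P : geomTorsion W (ℓ : ℤ), τ • P = -P := by
    rcases hasGoodReductionAt_or_forall_inertia_smul_eq_neg W F hw hgoodF h𝔓F hpv' hwv hH with hgood | h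
    · exact absurd hgood hnotgood
    · exact h
  have h𝔓 : 𝔓F.comap (absIntegersMap ℚ F) ∈ v.primesAbove := comap_absIntegersMap_mem_primesAbove hwv h𝔓F
  -- `F = ℚ(√d)`, `d` squarefree, and the twist `E^{(d)}` is good at `p`
  obtain ⟨d, y, hd0, hdsq, hysq, hHd⟩ := exists_squarefree_sq_eq_stabilizer F hF
  have hd0' : (d : ℚ) ≠ 0 := by exact_mod_cast hd0
  set Wd : WeierstrassCurve ℚ := W.quadraticTwist (d : ℚ) with hWd
  haveI : Wd.IsElliptic := W.isElliptic_quadraticTwist hd0'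
  have hWdgood : Wd.HasGoodReductionAt v :=
    hasGoodReductionAt_quadraticTwist_of_forall_inertia_smul_eq_neg W F hw hgoodF h𝔓F hpv' hwv hS hneg hd0' hHd
  -- `p ∣ d`: otherwise inertia fixes `√d` and `σ₀ ∈ H`
  have hpd : (p : ℤ) ∣ d := by
    by_contra hpd
    exact hσ₀H ((hHd σ₀).mpr (smul_geomSqrt_eq_of_mem_inertia (p := p) (not_dvd_four_mul hpP hp2 hpd) hpv h𝔓 hσ₀I))
  obtain ⟨m, hm⟩ := hpd
  have hpm : ¬ (p : ℤ) ∣ m := by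
    rintro ⟨k, rfl⟩
    have hpp : (p : ℤ) * p ∣ d := ⟨k, by rw [hm]; ring⟩
    have hu := hdsq (p : ℤ) hpp
    rw [Int.isUnit_iff_natAbs_eq, Int.natAbs_natCast] at hu
    exact hpP.one_lt.ne' hu
  -- the unit part `u = (−1)^{p/2} m`: squarefree, prime to `2p`
  set u : ℤ := (-1) ^ (p / 2) * m with hu
  have hunat : u.natAbs = m.natAbs := by
    rw [hu, Int.natAbs_mul, Int.natAbs_pow, Int.natAbs_neg, Int.natAbs_one, one_pow, one_mul]
  have husq : Squarefree u := by
    rw [← Int.squarefree_natAbs, hunat, Int.squarefree_natAbs]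
    exact hdsq.squarefree_of_dvd ⟨p, by rw [hm, mul_comm]⟩
  have hpu : ¬ (p : ℤ) ∣ u := by
    rw [← Int.dvd_natAbs, hunat, Int.dvd_natAbs]; exact hpm
  have hp2u : ¬ (p : ℤ) ∣ 2 * u := by
    intro h
    rcases (Nat.prime_iff_prime_int.mp hpP).dvd_or_dvd h with h2 | h2
    · have : (p : ℤ) ∣ ((2 : ℕ) : ℤ) := by exact_mod_cast h2
      rw [Int.natCast_dvd_natCast] at this
      exact hp2 ((Nat.prime_dvd_prime_iff_eq hpP Nat.prime_two).mp this)
    · exact hpu h2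
  -- `E^{(p*)} ≅ (E^{(d)})^{(u)}`
  set ps : ℚ := (-1 : ℚ) ^ (p / 2) * p with hps
  have hps0 : ps ≠ 0 := pStar_ne_zero p
  have hscal : ps * (d : ℚ) ^ 2 = (d : ℚ) * ((u : ℚ) * (p : ℚ) ^ 2) := by
    rw [hps, hu, hm]; push_cast; ring
  obtain ⟨C₁, hC₁⟩ := exists_variableChange_quadraticTwist_mul_sq W ps (d : ℚ) hd0'
  obtain ⟨C₂, hC₂⟩ := exists_variableChange_quadraticTwist_mul_sq Wd (u : ℚ) (p : ℚ) (by exact_mod_cast hpP.ne_zero)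
  have hWp : (C₂⁻¹ * C₁) • W.quadraticTwist ps = Wd.quadraticTwist (u : ℚ) := by
    rw [mul_smul, hC₁, hscal, ← quadraticTwist_quadraticTwist, ← hWd, ← hC₂, inv_smul_smul]
  -- `(E^{(d)})^{(u)}` is good at `p`: twist by `u`, `p ∤ u`, of a good curve (on a global minimal model of `E^{(d)}`)
  obtain ⟨Cd, hCd⟩ := hasGlobalMinimalModel_rat_holds Wd
  haveI := hCd
  have hVdgood : (Cd • Wd).HasGoodReductionAt v := (hasGoodReductionAt_smul_iff_holds v Wd Cd).mpr hWdgood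
  have hv2 : ((primesEquiv v : Nat.Primes) : ℕ) ≠ 2 := by rw [hveq]; exact hp2
  have hvu : ¬ (((primesEquiv v : Nat.Primes) : ℕ) : ℤ) ∣ u := by rw [hveq]; exact hpu
  have htw := (AdditivePotMult.hasGoodReductionAt_quadraticTwist_of_not_dvd (Cd • Wd) v hv2 hvu hVdgood).2
  rw [WeierstrassCurve.quadraticTwist_smul Wd Cd (u : ℚ)] at htw
  have hWdu : (Wd.quadraticTwist (u : ℚ)).HasGoodReductionAt v := (hasGoodReductionAt_smul_iff_holds v _ _).mp htw
  have hWpgood : (W.quadraticTwist ps).HasGoodReductionAt v := by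
    rw [← hasGoodReductionAt_smul_iff_holds v _ (C₂⁻¹ * C₁), hWp]; exact hWdu
  -- `V` := a global minimal model of `E^{(p*)}`; the presentation `W = C • V^{(p*)}`
  haveI := W.isElliptic_quadraticTwist hps0
  obtain ⟨CV, hCV⟩ := hasGlobalMinimalModel_rat_holds (W.quadraticTwist ps)
  haveI := hCV
  have hVgoodv : (CV • W.quadraticTwist ps).HasGoodReductionAt v := (hasGoodReductionAt_smul_iff_holds v _ CV).mpr hWpgood
  have hVgood : (CV • W.quadraticTwist ps).HasGoodReductionAtPrime p :=
    (CV • W.quadraticTwist ps).hasGoodReductionAtPrime_of_hasGoodReductionAt v hpv hVgoodv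
  obtain ⟨D, hD⟩ := exists_quadraticTwist_quadraticTwist_eq_smul W hps0
  have hpres : ((⟨CV.u, ps * CV.r, 0, 0⟩ : VariableChange ℚ) * D)⁻¹ • (CV • W.quadraticTwist ps).quadraticTwist ps = W := by
    rw [WeierstrassCurve.quadraticTwist_smul, hD, ← mul_smul, ← mul_smul, mul_assoc, inv_mul_cancel, one_smul]
  -- ordinarity: `E^{(d)}_F ≅ E_F` has unit root at `w`; it descends to the minimal model `Cd • E^{(d)}`; twist stability to `V`
  have hysq' : y ^ 2 = algebraMap ℚ F (d : ℚ) := by rw [hysq, map_intCast]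
  have hy0 : y ≠ 0 := by
    intro h0; rw [h0, zero_pow two_ne_zero] at hysq
    exact hd0 (by exact_mod_cast hysq.symm)
  obtain ⟨CF, hCF⟩ := exists_variableChange_baseChange_eq_quadraticTwist W F hysq' hy0
  have hVdF : (Cd • Wd).baseChange F = (Cd.map (algebraMap ℚ F) * CF) • W.baseChange F := by
    rw [mul_smul, hCF, hWd, baseChange, baseChange, map_variableChange]
  haveI : ((Cd • Wd).baseChange F).IsElliptic := inferInstanceAs ((Cd • Wd).map (algebraMap ℚ F)).IsElliptic
  have hunitVd : ((Cd • Wd).baseChange F).HasUnitRootAt w := by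
    rw [hVdF, hasUnitRootAt_smul_iff (W.baseChange F) _ w hgoodF]; exact hunitF
  have hVdgoodp : (Cd • Wd).HasGoodReductionAtPrime p := (Cd • Wd).hasGoodReductionAtPrime_of_hasGoodReductionAt v hpv hVdgood
  have hordVd : ¬ (p : ℤ) ∣ (Cd • Wd).frobeniusTrace p :=
    not_dvd_frobeniusTrace_of_hasUnitRootAt_baseChange (Cd • Wd) F hw hVdgoodp hunitVd
  -- `V ≅ (Cd • Wd)^{(u)}` up to a change of variables, so `p ∤ a_p(V)` by twist stability
  have hCV' : (((⟨Cd.u, (u : ℚ) * Cd.r, 0, 0⟩ : VariableChange ℚ) * (C₂⁻¹ * C₁) * CV⁻¹) • (CV • W.quadraticTwist ps)) =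
      (Cd • Wd).quadraticTwist (u : ℚ) := by
    rw [mul_smul, mul_smul, inv_smul_smul, hWp, WeierstrassCurve.quadraticTwist_smul]
  have hordV : ¬ (p : ℤ) ∣ (CV • W.quadraticTwist ps).frobeniusTrace p := by
    rw [Supersingular.dvd_frobeniusTrace_iff_of_smul_eq_quadraticTwist (Cd • Wd) (CV • W.quadraticTwist ps) p husq hCV' hp2u
      hVdgoodp]
    exact hordVd
  exact ⟨CV • W.quadraticTwist ps, inferInstance, hCV, _, ⟨hVgood, hordV⟩, hpres⟩

end NormalForm

end Summit.BirchSwinnertonDyer.BirchSwinnertonDyer.Theorems.SchneiderFreeAdditiveX3.QuadraticGoodReductionDescent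

end
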